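import Summits.QuantumFields.YangMills.Theorems.UnitScaleTiltAvgActionDefectFirstOrder
import HarnessLib

/-!
# Route `UnitScaleTilt`, crux K1 child «MinimiserStabilityRegPr» (stmt-QuantumFields-19200) — helper 5: THE FIRST-ORDER IDENTITY FOR THE
# COARSE PLAQUETTE OF THE (0.4)-AVERAGED FIELD, `Ū(∂p′) = mean_{x ∈ B(y), Γ ∈ G(y,x)} U(Γ)·U(∂R_{L,L}(x))·U(Γ)⁻¹ + O(t²)`

Cell `ym3-torus` (HUMAN RULING D-0037, YM ladder rung R3), seat `ym3-torus-p1` gen 8 (UV side).  Helper 3 (`UnitScaleTiltAvgActionDefectFirstOrder`,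
`dist1_plaqHol_avgFun_le_mean_add`) exports only the NORM consequence used by the action defect (`stub_avgActionDefect`, landed p437535); the
two remaining geometry stubs of the layer-4 v3b birth — `stub_avgCurvGrad` (G-K1a-3a′: coarse covariant differences of the averaged curvature
`≤ C₁b + C₂a²`) and `stub_smoothLift` (G-K1a-2′, clause (iii)) — need the IDENTITY itself: the coarse plaquette of `Ū = avgFun ℰ U` at
`p′ = (y; μ < ν)` is, up to `435t²` in operator norm (`t = (((d+2)L)²/4)·a`), the uniform average over the block points `x = blockSite y r` and
the staircases `Γ^σ_{y,r} ∈ G(y, x)` of [Balaban1987RG1] (0.3) of the transported `L × L` square holonomies `U(Γ)·U(∂R_{L,L}(x; μ, ν))·U(Γ)⁻¹`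
(**`norm_plaqHol_avgFun_sub_mean_conj_rect_le`**, `SU(N)`, printed `exp[mean log]`, standing range).  The `O(t²) = O(L⁴a²)` remainder is the
`C₂a²` of those stubs; the difference of the means at neighbouring coarse plaquettes telescopes into `L`-step fine covariant differences of square
holonomies (abelian count `C₁ ≍ L³`).  Also `mean_comp_fst'` (uniform-fibre averaging onto any first factor).
-/

noncomputable section

open NormedSpace
open scoped BigOperators Matrix.Norms.L2Operator

namespace Summit.QuantumFields.YangMills.Theorems.AvgActionDefect

open Literature.MathematicalPhysics.QuantumFieldTheory.Balaban1983to89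
open T4Continuum BlockAveraging AveragingRT B10Eq47AxialChi ExpMeanLog LatticeWordStokes BlockAveragingPlaquetteBound

/-! ## The first-order IDENTITY behind helper 3, exported for the gradient stubs -/

section Identity

variable {n : Type*} [Fintype n] [DecidableEq n] [Nonempty n] {P : Params} {j : ℕ}

/-- In the model, `dist1 g = ‖g − 1‖` (operator norm). [folklore] -/
private theorem dist1_su_eq' (g : Matrix.specialUnitaryGroup n ℂ) : dist1 g = ‖(g : Matrix n n ℂ) - 1‖ := rfl

/-- A special unitary matrix has operator norm `≤ 1`. [folklore] -/
private theorem norm_coe_su_le_one' (g : Matrix.specialUnitaryGroup n ℂ) : ‖(g : Matrix n n ℂ)‖ ≤ 1 :=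
  (UnitaryModel.norm_of_mem_unitaryGroup (Matrix.specialUnitaryGroup_le_unitaryGroup g.2)).le

/-- Averaging `f ∘ (first component of a product decomposition)` over the product is averaging `f` over the first factor (any target type;
`mean_comp_fst` is the case of `Idx P`). [folklore] -/
theorem mean_comp_fst' {𝔸 : Type*} [AddCommGroup 𝔸] [Module ℂ 𝔸] {K T M : Type*} [Fintype K] [Fintype T] [Fintype M] [Nonempty M]
    (e : K ≃ T × M) (f : T → 𝔸) :
    ((Fintype.card K : ℂ))⁻¹ • ∑ k : K, f (e k).1 = ((Fintype.card T : ℂ))⁻¹ • ∑ t : T, f t := by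
  have hM : (Fintype.card M : ℂ) ≠ 0 := by exact_mod_cast Fintype.card_ne_zero
  rw [Fintype.card_congr e, Fintype.sum_equiv e (fun k => f (e k).1) (fun q => f q.1) (fun _ => rfl), Fintype.card_prod,
    Fintype.sum_prod_type]
  simp only [Finset.sum_const, Finset.card_univ]
  rw [← Finset.smul_sum, ← Nat.cast_smul_eq_nsmul ℂ, smul_smul, Nat.cast_mul, mul_inv, mul_assoc, inv_mul_cancel₀ hM,
    mul_one]

/-- **THE COARSE PLAQUETTE OF THE (0.4)-AVERAGED FIELD IS, TO FIRST ORDER, THE AVERAGE OVER THE BLOCK POINTS `x = blockSite y r` AND THE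
STAIRCASES `Γ ∈ G(y, x)` OF THE TRANSPORTED SQUARE HOLONOMIES `U(Γ)·U(∂R_{L,L}(x))·U(Γ)⁻¹`** (standing range; `SU(N)`, printed `exp[mean log]`;
`PlaqSmall a U`, `a ≥ 0`, `t := (((d+2)L)²/4)·a ≤ 1/10`, `t < δ_N`):
`‖Ū(∂p′) − |R × S_d|⁻¹ Σ_{(r,σ)} U(Γ^σ_{y,r})·U(∂R_{L,L}(blockSite y r; μ, ν))·U(Γ^σ_{y,r})⁻¹‖ ≤ 435·t²` (operator norm in `M_N(ℂ)`) — the identity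
whose norm consequence is §3's `dist1_plaqHol_avgFun_le_mean_add`; the tool for the coarse covariant DIFFERENCES of the averaged curvature (located
gaps G-K1a-3a′ `AvgCurvGradAt`, G-K1a-2′ `SmoothLiftAt` (iii)): the `O(t²) = O(L⁴a²)` remainder is their `C₂a²`. [cite: Balaban1987RG1, (0.4) p.253] -/
theorem norm_plaqHol_avgFun_sub_mean_conj_rect_le (hj : j + 1 ≤ P.m + P.K) {a : ℝ} (ha : 0 ≤ a)
    {U : GaugeField P j (Matrix.specialUnitaryGroup n ℂ)} (hU : PlaqSmall a U)
    (ht : ((((P.d + 2) * P.L : ℕ) : ℝ) ^ 2 / 4) * a ≤ 1 / 10) (hδ : ((((P.d + 2) * P.L : ℕ) : ℝ) ^ 2 / 4) * a < deltaSU n)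
    (p : Plaq P (j + 1)) :
    ‖((GaugeField.plaqHol (avgFun (expMeanLogSU (n := n)) U) p : Matrix.specialUnitaryGroup n ℂ) : Matrix n n ℂ) -
        ((Fintype.card ((Fin P.d → Fin P.L) × Equiv.Perm (Fin P.d)) : ℂ))⁻¹ •
          ∑ q : (Fin P.d → Fin P.L) × Equiv.Perm (Fin P.d),
            ((holAt U (walk (emb p.src) (stairWord q.2 (off q.1))) * rect U (Site.blockSite p.src q.1) p.μ p.ν P.L P.L *
                (holAt U (walk (emb p.src) (stairWord q.2 (off q.1))))⁻¹ : Matrix.specialUnitaryGroup n ℂ) : Matrix n n ℂ)‖ ≤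
      435 * (((((P.d + 2) * P.L : ℕ) : ℝ) ^ 2 / 4) * a) ^ 2 := by
  -- notation
  set τ : ℝ := ((((P.d + 2) * P.L : ℕ) : ℝ) ^ 2 / 4) * a with hτ
  have hτ0 : 0 ≤ τ := by positivity
  let K : Type := (Fin P.d → Fin P.L) × Equiv.Perm (Fin P.d) × Equiv.Perm (Fin P.d) × Equiv.Perm (Fin P.d) × Equiv.Perm (Fin P.d)
  haveI : Nonempty K := ⟨(fun _ => ⟨0, P.L_pos⟩, 1, 1, 1, 1)⟩
  -- the coupled index decomposed along the four matched projections and along `(r, σ₀)`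
  let e₁ : K ≃ Idx P × (Equiv.Perm (Fin P.d) × Equiv.Perm (Fin P.d)) :=
    ⟨fun k => ((k.1, k.2.1, k.2.2.1), (k.2.2.2.1, k.2.2.2.2)), fun q => (q.1.1, q.1.2.1, q.1.2.2, q.2.1, q.2.2),
      fun _ => rfl, fun _ => rfl⟩
  let e₂ : K ≃ Idx P × (Equiv.Perm (Fin P.d) × Equiv.Perm (Fin P.d)) :=
    ⟨fun k => ((k.1, k.2.2.1, k.2.2.2.1), (k.2.1, k.2.2.2.2)), fun q => (q.1.1, q.2.1, q.1.2.1, q.1.2.2, q.2.2),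
      fun _ => rfl, fun _ => rfl⟩
  let e₃ : K ≃ Idx P × (Equiv.Perm (Fin P.d) × Equiv.Perm (Fin P.d)) :=
    ⟨fun k => ((k.1, k.2.2.2.2, k.2.2.2.1), (k.2.1, k.2.2.1)), fun q => (q.1.1, q.2.1, q.2.2, q.1.2.2, q.1.2.1),
      fun _ => rfl, fun _ => rfl⟩
  let e₄ : K ≃ Idx P × (Equiv.Perm (Fin P.d) × Equiv.Perm (Fin P.d)) :=
    ⟨fun k => ((k.1, k.2.1, k.2.2.2.2), (k.2.2.1, k.2.2.2.1)), fun q => (q.1.1, q.1.2.1, q.2.1, q.2.2, q.1.2.2),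
      fun _ => rfl, fun _ => rfl⟩
  let e₀ : K ≃ ((Fin P.d → Fin P.L) × Equiv.Perm (Fin P.d)) × (Equiv.Perm (Fin P.d) × Equiv.Perm (Fin P.d) × Equiv.Perm (Fin P.d)) :=
    ⟨fun k => ((k.1, k.2.1), (k.2.2.1, k.2.2.2.1, k.2.2.2.2)), fun q => (q.1.1, q.1.2, q.2.1, q.2.2.1, q.2.2.2),
      fun _ => rfl, fun _ => rfl⟩
  -- the four bonds, correction factors, straight transporters
  set c₁ : PBond P (j + 1) := ⟨p.src, p.μ⟩ with hc₁
  set c₂ : PBond P (j + 1) := ⟨p.src.shift p.μ, p.ν⟩ with hc₂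
  set c₃ : PBond P (j + 1) := ⟨p.src.shift p.ν, p.μ⟩ with hc₃
  set c₄ : PBond P (j + 1) := ⟨p.src, p.ν⟩ with hc₄
  set E₁ : Matrix.specialUnitaryGroup n ℂ := corr (expMeanLogSU (n := n)) U c₁ with hE₁
  set E₂ : Matrix.specialUnitaryGroup n ℂ := corr (expMeanLogSU (n := n)) U c₂ with hE₂
  set E₃ : Matrix.specialUnitaryGroup n ℂ := corr (expMeanLogSU (n := n)) U c₃ with hE₃
  set E₄ : Matrix.specialUnitaryGroup n ℂ := corr (expMeanLogSU (n := n)) U c₄ with hE₄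
  set A₁ : Matrix.specialUnitaryGroup n ℂ := axialAvg U c₁ with hA₁
  set A₂ : Matrix.specialUnitaryGroup n ℂ := axialAvg U c₂ with hA₂
  set A₃ : Matrix.specialUnitaryGroup n ℂ := axialAvg U c₃ with hA₃
  set A₄ : Matrix.specialUnitaryGroup n ℂ := axialAvg U c₄ with hA₄
  -- smallness facts
  have hloop : ∀ (c : PBond P (j + 1)) (i : Idx P), dist1 (loopHol U c i) ≤ τ := fun c i => dist1_loopHol_le ha hU c i
  have hcorr : ∀ c : PBond P (j + 1), dist1 (corr (expMeanLogSU (n := n)) U c) ≤ 6 * τ := fun c => dist1_corr_le ha hU hδ c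
  have h6τ : 6 * τ ≤ 1 := by linarith
  have hτ1 : τ ≤ 1 := by linarith
  -- the four correction factors to first order, means transported to the coupled index
  have hρ₁ : ‖(E₁ : Matrix n n ℂ) - 1 - ((Fintype.card K : ℂ))⁻¹ •
      ∑ k : K, (((loopHol U c₁ (k.1, k.2.1, k.2.2.1) : Matrix.specialUnitaryGroup n ℂ) : Matrix n n ℂ) - 1)‖ ≤ 7 * τ ^ 2 := by
    have h : ((Fintype.card K : ℂ))⁻¹ •
        ∑ k : K, (((loopHol U c₁ (k.1, k.2.1, k.2.2.1) : Matrix.specialUnitaryGroup n ℂ) : Matrix n n ℂ) - 1) =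
        ((Fintype.card (Idx P) : ℂ))⁻¹ • ∑ i : Idx P, (((loopHol U c₁ i : Matrix.specialUnitaryGroup n ℂ) : Matrix n n ℂ) - 1) :=
      mean_comp_fst e₁ (fun i => ((loopHol U c₁ i : Matrix.specialUnitaryGroup n ℂ) : Matrix n n ℂ) - 1)
    rw [h]
    exact norm_corr_sub_mean_le ha hU ht hδ c₁
  have hρ₂ : ‖(E₂ : Matrix n n ℂ) - 1 - ((Fintype.card K : ℂ))⁻¹ •
      ∑ k : K, (((loopHol U c₂ (k.1, k.2.2.1, k.2.2.2.1) : Matrix.specialUnitaryGroup n ℂ) : Matrix n n ℂ) - 1)‖ ≤ 7 * τ ^ 2 := by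
    have h : ((Fintype.card K : ℂ))⁻¹ •
        ∑ k : K, (((loopHol U c₂ (k.1, k.2.2.1, k.2.2.2.1) : Matrix.specialUnitaryGroup n ℂ) : Matrix n n ℂ) - 1) =
        ((Fintype.card (Idx P) : ℂ))⁻¹ • ∑ i : Idx P, (((loopHol U c₂ i : Matrix.specialUnitaryGroup n ℂ) : Matrix n n ℂ) - 1) :=
      mean_comp_fst e₂ (fun i => ((loopHol U c₂ i : Matrix.specialUnitaryGroup n ℂ) : Matrix n n ℂ) - 1)
    rw [h]
    exact norm_corr_sub_mean_le ha hU ht hδ c₂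
  have hρ₃ : ‖((E₃⁻¹ : Matrix.specialUnitaryGroup n ℂ) : Matrix n n ℂ) - 1 - ((Fintype.card K : ℂ))⁻¹ •
      ∑ k : K, ((((loopHol U c₃ (k.1, k.2.2.2.2, k.2.2.2.1))⁻¹ : Matrix.specialUnitaryGroup n ℂ) : Matrix n n ℂ) - 1)‖ ≤
      7 * τ ^ 2 := by
    have h : ((Fintype.card K : ℂ))⁻¹ •
        ∑ k : K, ((((loopHol U c₃ (k.1, k.2.2.2.2, k.2.2.2.1))⁻¹ : Matrix.specialUnitaryGroup n ℂ) : Matrix n n ℂ) - 1) =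
        ((Fintype.card (Idx P) : ℂ))⁻¹ •
          ∑ i : Idx P, ((((loopHol U c₃ i)⁻¹ : Matrix.specialUnitaryGroup n ℂ) : Matrix n n ℂ) - 1) :=
      mean_comp_fst e₃ (fun i => (((loopHol U c₃ i)⁻¹ : Matrix.specialUnitaryGroup n ℂ) : Matrix n n ℂ) - 1)
    rw [h]
    exact norm_corr_inv_sub_mean_le ha hU ht hδ c₃
  have hρ₄ : ‖((E₄⁻¹ : Matrix.specialUnitaryGroup n ℂ) : Matrix n n ℂ) - 1 - ((Fintype.card K : ℂ))⁻¹ •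
      ∑ k : K, ((((loopHol U c₄ (k.1, k.2.1, k.2.2.2.2))⁻¹ : Matrix.specialUnitaryGroup n ℂ) : Matrix n n ℂ) - 1)‖ ≤
      7 * τ ^ 2 := by
    have h : ((Fintype.card K : ℂ))⁻¹ •
        ∑ k : K, ((((loopHol U c₄ (k.1, k.2.1, k.2.2.2.2))⁻¹ : Matrix.specialUnitaryGroup n ℂ) : Matrix n n ℂ) - 1) =
        ((Fintype.card (Idx P) : ℂ))⁻¹ •
          ∑ i : Idx P, ((((loopHol U c₄ i)⁻¹ : Matrix.specialUnitaryGroup n ℂ) : Matrix n n ℂ) - 1) :=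
      mean_comp_fst e₄ (fun i => (((loopHol U c₄ i)⁻¹ : Matrix.specialUnitaryGroup n ℂ) : Matrix n n ℂ) - 1)
    rw [h]
    exact norm_corr_inv_sub_mean_le ha hU ht hδ c₄
  -- helper 1 at these matrices
  have main := norm_prod4_sub_mean_le (𝔸 := Matrix n n ℂ) (κ := K)
    (g₁ := (A₁ : Matrix n n ℂ)) (g₂ := ((A₂ * A₃⁻¹ : Matrix.specialUnitaryGroup n ℂ) : Matrix n n ℂ))
    (g₃ := ((A₄⁻¹ : Matrix.specialUnitaryGroup n ℂ) : Matrix n n ℂ))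
    (X₁ := (E₁ : Matrix n n ℂ) - 1) (X₂ := (E₂ : Matrix n n ℂ) - 1)
    (X₃ := ((E₃⁻¹ : Matrix.specialUnitaryGroup n ℂ) : Matrix n n ℂ) - 1)
    (X₄ := ((E₄⁻¹ : Matrix.specialUnitaryGroup n ℂ) : Matrix n n ℂ) - 1)
    (Y₁ := fun k : K => ((loopHol U c₁ (k.1, k.2.1, k.2.2.1) : Matrix.specialUnitaryGroup n ℂ) : Matrix n n ℂ) - 1)
    (Y₂ := fun k : K => ((loopHol U c₂ (k.1, k.2.2.1, k.2.2.2.1) : Matrix.specialUnitaryGroup n ℂ) : Matrix n n ℂ) - 1)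
    (Y₃ := fun k : K => (((loopHol U c₃ (k.1, k.2.2.2.2, k.2.2.2.1))⁻¹ : Matrix.specialUnitaryGroup n ℂ) : Matrix n n ℂ) - 1)
    (Y₄ := fun k : K => (((loopHol U c₄ (k.1, k.2.1, k.2.2.2.2))⁻¹ : Matrix.specialUnitaryGroup n ℂ) : Matrix n n ℂ) - 1)
    (s := 6 * τ) (t := τ) (ρ := 7 * τ ^ 2)
    (norm_coe_su_le_one' _) (norm_coe_su_le_one' _) (norm_coe_su_le_one' _)
    (by rw [← dist1_su_eq']; exact hcorr c₁) (by rw [← dist1_su_eq']; exact hcorr c₂)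
    (by rw [← dist1_su_eq', GaugeGroup.dist1_inv]; exact hcorr c₃)
    (by rw [← dist1_su_eq', GaugeGroup.dist1_inv]; exact hcorr c₄) h6τ
    (fun k => by rw [← dist1_su_eq']; exact hloop c₁ _) (fun k => by rw [← dist1_su_eq']; exact hloop c₂ _)
    (fun k => by rw [← dist1_su_eq', GaugeGroup.dist1_inv]; exact hloop c₃ _)
    (fun k => by rw [← dist1_su_eq', GaugeGroup.dist1_inv]; exact hloop c₄ _) hτ1 hρ₁ hρ₂ hρ₃ hρ₄
  -- identify the two products with the coarse plaquette and the conjugated squares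
  have hprod : (1 + ((E₁ : Matrix n n ℂ) - 1)) * (A₁ : Matrix n n ℂ) * (1 + ((E₂ : Matrix n n ℂ) - 1)) *
      ((A₂ * A₃⁻¹ : Matrix.specialUnitaryGroup n ℂ) : Matrix n n ℂ) *
      (1 + (((E₃⁻¹ : Matrix.specialUnitaryGroup n ℂ) : Matrix n n ℂ) - 1)) * ((A₄⁻¹ : Matrix.specialUnitaryGroup n ℂ) : Matrix n n ℂ) *
      (1 + (((E₄⁻¹ : Matrix.specialUnitaryGroup n ℂ) : Matrix n n ℂ) - 1)) =
      ((GaugeField.plaqHol (avgFun (expMeanLogSU (n := n)) U) p : Matrix.specialUnitaryGroup n ℂ) : Matrix n n ℂ) := by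
    simp only [add_sub_cancel]
    have : GaugeField.plaqHol (avgFun (expMeanLogSU (n := n)) U) p = E₁ * A₁ * E₂ * (A₂ * A₃⁻¹) * E₃⁻¹ * A₄⁻¹ * E₄⁻¹ := by
      show E₁ * A₁ * (E₂ * A₂) * (E₃ * A₃)⁻¹ * (E₄ * A₄)⁻¹ = _
      group
    rw [this]
    simp only [Submonoid.coe_mul]
  have hloops : ∀ k : K,
      (1 + (((loopHol U c₁ (k.1, k.2.1, k.2.2.1) : Matrix.specialUnitaryGroup n ℂ) : Matrix n n ℂ) - 1)) * (A₁ : Matrix n n ℂ) *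
      (1 + (((loopHol U c₂ (k.1, k.2.2.1, k.2.2.2.1) : Matrix.specialUnitaryGroup n ℂ) : Matrix n n ℂ) - 1)) *
      ((A₂ * A₃⁻¹ : Matrix.specialUnitaryGroup n ℂ) : Matrix n n ℂ) *
      (1 + ((((loopHol U c₃ (k.1, k.2.2.2.2, k.2.2.2.1))⁻¹ : Matrix.specialUnitaryGroup n ℂ) : Matrix n n ℂ) - 1)) *
      ((A₄⁻¹ : Matrix.specialUnitaryGroup n ℂ) : Matrix n n ℂ) *
      (1 + ((((loopHol U c₄ (k.1, k.2.1, k.2.2.2.2))⁻¹ : Matrix.specialUnitaryGroup n ℂ) : Matrix n n ℂ) - 1)) =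
      ((holAt U (walk (emb p.src) (stairWord k.2.1 (off k.1))) * rect U (Site.blockSite p.src k.1) p.μ p.ν P.L P.L *
          (holAt U (walk (emb p.src) (stairWord k.2.1 (off k.1))))⁻¹ : Matrix.specialUnitaryGroup n ℂ) : Matrix n n ℂ) := by
    intro k
    simp only [add_sub_cancel]
    rw [← fourLoops_eq_conj_rect hj U p k.1 k.2.1 k.2.2.1 k.2.2.2.1 k.2.2.2.2]
    have : loopHol U c₁ (k.1, k.2.1, k.2.2.1) * A₁ * (loopHol U c₂ (k.1, k.2.2.1, k.2.2.2.1) * A₂) *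
        (loopHol U c₃ (k.1, k.2.2.2.2, k.2.2.2.1) * A₃)⁻¹ * (loopHol U c₄ (k.1, k.2.1, k.2.2.2.2) * A₄)⁻¹ =
        loopHol U c₁ (k.1, k.2.1, k.2.2.1) * A₁ * loopHol U c₂ (k.1, k.2.2.1, k.2.2.2.1) * (A₂ * A₃⁻¹) *
          (loopHol U c₃ (k.1, k.2.2.2.2, k.2.2.2.1))⁻¹ * A₄⁻¹ * (loopHol U c₄ (k.1, k.2.1, k.2.2.2.2))⁻¹ := by group
    rw [this]
    simp only [Submonoid.coe_mul]
  have hmean : ((Fintype.card K : ℂ))⁻¹ • ∑ k : K,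
      ((holAt U (walk (emb p.src) (stairWord k.2.1 (off k.1))) * rect U (Site.blockSite p.src k.1) p.μ p.ν P.L P.L *
          (holAt U (walk (emb p.src) (stairWord k.2.1 (off k.1))))⁻¹ : Matrix.specialUnitaryGroup n ℂ) : Matrix n n ℂ) =
      ((Fintype.card ((Fin P.d → Fin P.L) × Equiv.Perm (Fin P.d)) : ℂ))⁻¹ •
        ∑ q : (Fin P.d → Fin P.L) × Equiv.Perm (Fin P.d),
          ((holAt U (walk (emb p.src) (stairWord q.2 (off q.1))) * rect U (Site.blockSite p.src q.1) p.μ p.ν P.L P.L *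
              (holAt U (walk (emb p.src) (stairWord q.2 (off q.1))))⁻¹ : Matrix.specialUnitaryGroup n ℂ) : Matrix n n ℂ) :=
    mean_comp_fst' e₀ (fun q : (Fin P.d → Fin P.L) × Equiv.Perm (Fin P.d) =>
      ((holAt U (walk (emb p.src) (stairWord q.2 (off q.1))) * rect U (Site.blockSite p.src q.1) p.μ p.ν P.L P.L *
        (holAt U (walk (emb p.src) (stairWord q.2 (off q.1))))⁻¹ : Matrix.specialUnitaryGroup n ℂ) : Matrix n n ℂ))
  rw [hprod, Finset.sum_congr rfl fun k _ => hloops k, hmean] at main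
  have h435 : 4 * (7 * τ ^ 2) + 11 * (6 * τ) ^ 2 + 11 * τ ^ 2 = 435 * τ ^ 2 := by ring
  linarith [main, h435]

end Identity

end Summit.QuantumFields.YangMills.Theorems.AvgActionDefect

end
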